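/-
Copyright: b2b-lace packet (explicit-unit carver, gen 18).  The R228 re-cut of the improvement-step oracle
(`NobleImprovementInputsRem`, node N68g) stated over a GENERAL finite family of weighted diagrams
`𝒮 : ι → ℕ × ℕ × Set (Site d)` (`NobleInstantiateFamily`, node N67-O), with coherence to the record's
`NobleImprovementInputsRemAt` at `𝒮 = nobleTriple d` (`Iff.rfl`) and the Stage-2 theorems unchanged.
-/
import Literature.Probability.FitznerVanDerHofstad2017.NobleInstantiateFamily
import Literature.Probability.FitznerVanDerHofstad2017.NobleImprovementInputsRem
import HarnessLib

/-!
# The re-cut improvement oracle over a general finite family of weighted diagrams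

CITATION HEADER (PLACEMENT v2). This module is part of a certified REPRODUCTION of:
R. Fitzner, R. van der Hofstad, *Mean-field behavior for nearest-neighbor percolation in d > 10*,
Electron. J. Probab. 22 (2017), no. 43, 1–65 [FvdH17], and *Generalized approach to the non-backtracking
lace expansion*, Probab. Theory Related Fields 169 (2017), 1041–1119 [NoBLE17-I] (arXiv:1506.07977, 1506.07969).
Reproduces: the proof-structure reading of [FvdH17] §4.2 (4.18) with [NoBLE17-I] (5.22)–(5.27), §5.3.2 (first
display, p. 1097) typed in `NobleImprovementInputsRem` (the trail remainder of every chain enters the coefficient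
bounds ONLY through an upper bound `Rem_c ≤ Γ̄₂ⁿ·R`), now for the bootstrap function `f₃` over an arbitrary finite
index set `𝒮` ([NoBLE17-I] (2.7): "`𝒮` is some finite set of indices", arXiv:1506.07969 p. 27).  Origin: build
`lace`, node N67-O (second half) of the packet's `LEMMAS.md`.

## What is here

`NobleImprovementInputsRem` re-cuts the improvement-step oracle of record one binder finer (REFEREE R228):
`NobleImprovementInputsRemAt d CS cμ c Γ R B b := RemValid d CS R → NobleImprovementInputsAt d cμ c Γ B b` — "IF the
ten abstract remainder constants `R` are kernel-valid for every admissible composition of their read, THEN `(B, b)`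
is a valid improvement-step table at `Γ`" — over the record family `nobleTriple d : Fin 6 → …` of [FvdH17] (2.23).
`NobleInstantiateFamily` states the oracle of record over a general family `𝒮 : ι → ℕ × ℕ × Set (Site d)`
(`NobleImprovementInputsOf`).  This module is the re-cut over `𝒮`:

* `NobleImprovementInputsRemOf 𝒮 CS cμ c Γ R B b := RemValid d CS R → NobleImprovementInputsOf 𝒮 cμ c Γ B b`,
  with `nobleImprovementInputsRemOf_nobleTriple_iff : … (nobleTriple d) … ↔ NobleImprovementInputsRemAt d …`
  (`Iff.rfl`): the record re-cut is the case `𝒮 = nobleTriple d`, definitionally;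
* COHERENCE with the oracle over `𝒮` (R228 (2), verbatim from `NobleImprovementInputsRem`):
  `nobleImprovementInputsOf_of_remOf` (any kernel-valid `R`), `nobleImprovementInputsOf_of_remOf_print`
  (`R = remPrint d CS`, the constants of the PRINTED chain, kernel-valid for `d ≥ 9` by `remValid_remPrint`),
  `nobleImprovementInputsOf_of_remOf_ksup` (`R = remKsup d CS T`, the record-faithful valuation, given the sup-table
  hypothesis `hT`), the trivial converse `nobleImprovementInputsRemOf_of_inputsOf`, antitonicity in `R`
  (`NobleImprovementInputsRemOf.anti`) and monotonicity under outward rounding (`NobleImprovementInputsRemOf.mono`);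
* STAGE 2 UNCHANGED: `nobleBootstrapBound_of_certificateRemOf` (`d ≥ 2`), `meanField_of_certificateRemOf`,
  `gamma_eq_one_of_certificateRemOf` (`d ≥ 7`) = the theorems of `NobleInstantiateFamily` with `hS` replaced by
  `(hR : RemValid d CS R) (hS : NobleImprovementInputsRemOf 𝒮 CS cμ c Γ R Bo bo)`.

The read index `RemRead` (the ten hooked remainder reads of the Stage-1 notebook, DIVERGENCE.md D55), `RemValid`,
`remPrint`, `remKsup`, `remValid_of_nbwJ_le` (the N53 discharge shape) are those of `NobleImprovementInputsRem`,
unchanged: the remainder reads belong to the coefficient bounds ([FvdH17] §4), which do not depend on the choice of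
`𝒮`; a family `𝒮` with further weighted diagrams changes `f₃` and the diagram-bound vector `b : ι → ℝ` only.

## What is NOT here

No numerals, no dimension, no instance: with numeric `B`, `b`, `R` the binder `NobleImprovementInputsRemOf` is the
programme's EVALUATION of the published formulas (REFEREE V1(b)) — NOT CITABLE, and every theorem taking it is
CONDITIONAL, exactly as for `NobleImprovementInputsRemAt`; no `RemValid` instance is built here; the binders of
record (`NobleInstantiate`, `NobleImprovementInputsRem`, `NobleAssumptions`, `MeanFieldD11`, `MeanFieldD11Cert`)
are byte-unchanged.  No cited fact, no named hypothesis, no `sorry`.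

## References
* [NoBLE17-I] R. Fitzner, R. van der Hofstad, Generalized approach to the non-backtracking lace expansion,
  Probab. Theory Relat. Fields 169 (2017) 1041–1119; arXiv:1506.07969 — §2.1 (2.7), (5.22)–(5.27), §5.3.2 (first
  display) p. 1097, Prop. 2.11, Def. 2.9.
* [FvdH17] R. Fitzner, R. van der Hofstad, Mean-field behavior for nearest-neighbor percolation in `d > 10`,
  Electron. J. Probab. 22 (2017) no. 43; arXiv:1506.07977v2 — §4.2 (4.18), (2.23), Prop. 2.2, Thm. 1.1.
-/

noncomputable section

namespace Literature.Probability.FitznerVanDerHofstad2017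

open Literature.Barriers.CriticalPhenomena Literature.Probability.Percolation
open Literature.Probability.LatticeModels

variable {d : ℕ} {ι : Type*} [Fintype ι] [Nonempty ι]

/-! ### The re-cut oracle over a general family -/

/-- **THE RE-CUT IMPROVEMENT-STEP ORACLE over a general finite family `𝒮` of weighted diagrams** at dimension `d`,
closing length `CS`, bootstrap constants `Γ`, `c_μ`, `c`, abstract remainder constants `R : RemRead → ℝ` and output
table `(B, b)`: IF every `R r` is a valid remainder-kernel constant for its read (`RemValid d CS R`), THEN for every
`p ∈ (1/(2d-1), p_c)` with `f_i(p) ≤ Γ_i` (`f₃ = f₃^𝒮`) the two-point function has the simplified NoBLE form with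
Assumption-2.7 constants `B` and the weighted diagrams of `𝒮` are bounded by `b` — i.e.
`NobleImprovementInputsOf 𝒮 cμ c Γ B b`.  Word for word `NobleImprovementInputsRemAt` with `nobleTriple d ↦ 𝒮`
(`nobleImprovementInputsRemOf_nobleTriple_iff`); same READING ([FvdH17] §4.2 (4.18); [NoBLE17-I] (5.22)–(5.27),
§5.3.2 first display: the trail remainder enters only through `Rem_c ≤ Γ̄₂ⁿ·R`).  **NOT CITABLE once `B`, `b`, `R`
are numerals** (REFEREE V1(b)): the programme's evaluation of the published formulas, not a published theorem and
not kernel-proved; every theorem taking it is CONDITIONAL; no dimension sentence follows from it.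
[cite: FitznerVanDerHofstad2017, §4.2 (4.18) arXiv:1506.07977v2 p. 36 = EJP p. 33; Prop. 2.2, §2.3–§2.4]
[cite: FitznerVanDerHofstad2016NoBLE, (2.7); (5.22)–(5.27) and §5.3.2 (first display) p. 1097; Assumption 2.7] -/
def NobleImprovementInputsRemOf (𝒮 : ι → ℕ × ℕ × Set (Site d)) (CS : ℕ) (cμ : ℝ) (c : ι → ℝ)
    (Γ : Fin 3 → ℝ) (R : RemRead → ℝ) (B : NobleBeta) (b : ι → ℝ) : Prop :=
  RemValid d CS R → NobleImprovementInputsOf 𝒮 cμ c Γ B b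

/-- COHERENCE: over the record family `nobleTriple d` the general re-cut is the record's
`NobleImprovementInputsRemAt`, definitionally. [folklore] -/
theorem nobleImprovementInputsRemOf_nobleTriple_iff {CS : ℕ} {cμ : ℝ} {c : Fin 6 → ℝ} {Γ : Fin 3 → ℝ}
    {R : RemRead → ℝ} {B : NobleBeta} {b : Fin 6 → ℝ} :
    NobleImprovementInputsRemOf (nobleTriple d) CS cμ c Γ R B b ↔
      NobleImprovementInputsRemAt d CS cμ c Γ R B b :=
  Iff.rfl

/-- **COHERENCE, general form (R228 (2))**: at any kernel-valid table of remainder constants the re-cut over `𝒮`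
IMPLIES the oracle over `𝒮` at the same output table. [folklore] -/
theorem nobleImprovementInputsOf_of_remOf {𝒮 : ι → ℕ × ℕ × Set (Site d)} {CS : ℕ} {cμ : ℝ} {c : ι → ℝ}
    {Γ : Fin 3 → ℝ} {R : RemRead → ℝ} {B : NobleBeta} {b : ι → ℝ} (hR : RemValid d CS R)
    (hS : NobleImprovementInputsRemOf 𝒮 CS cμ c Γ R B b) : NobleImprovementInputsOf 𝒮 cμ c Γ B b :=
  hS hR

/-- The re-cut is the WEAKER hypothesis: the oracle over `𝒮` implies it at every `R`. [folklore] -/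
theorem nobleImprovementInputsRemOf_of_inputsOf {𝒮 : ι → ℕ × ℕ × Set (Site d)} {CS : ℕ} {cμ : ℝ}
    {c : ι → ℝ} {Γ : Fin 3 → ℝ} (R : RemRead → ℝ) {B : NobleBeta} {b : ι → ℝ}
    (hS : NobleImprovementInputsOf 𝒮 cμ c Γ B b) : NobleImprovementInputsRemOf 𝒮 CS cμ c Γ R B b :=
  fun _ => hS

/-- Antitonicity in the constants: the re-cut at LARGER constants `R'` implies the re-cut at `R ≤ R'`. [folklore] -/
theorem NobleImprovementInputsRemOf.anti {𝒮 : ι → ℕ × ℕ × Set (Site d)} {CS : ℕ} {cμ : ℝ} {c : ι → ℝ}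
    {Γ : Fin 3 → ℝ} {R R' : RemRead → ℝ} {B : NobleBeta} {b : ι → ℝ} (hle : ∀ r, R r ≤ R' r)
    (hS : NobleImprovementInputsRemOf 𝒮 CS cμ c Γ R' B b) : NobleImprovementInputsRemOf 𝒮 CS cμ c Γ R B b :=
  fun hR => hS (hR.of_le hle)

/-- Monotonicity under outward rounding of the output table (same `R`). [folklore] -/
theorem NobleImprovementInputsRemOf.mono {𝒮 : ι → ℕ × ℕ × Set (Site d)} {CS : ℕ} {cμ : ℝ} {c : ι → ℝ}
    {Γ : Fin 3 → ℝ} {R : RemRead → ℝ} {Bo Bo' : NobleBeta} {bo bo' : ι → ℝ} (hB : BetaLE Bo Bo')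
    (hb : ∀ k, bo k ≤ bo' k) (hS : NobleImprovementInputsRemOf 𝒮 CS cμ c Γ R Bo bo) :
    NobleImprovementInputsRemOf 𝒮 CS cμ c Γ R Bo' bo' :=
  fun hR => nobleImprovementInputsOf_mono hB hb (hS hR)

/-- **COHERENCE AT PRINT (R228 (2))**: the re-cut over `𝒮` at the constants of the printed chain `remPrint d CS`
IMPLIES the oracle over `𝒮`, with no further hypothesis (`d ≥ 9`, `remValid_remPrint`).
[cite: FitznerVanDerHofstad2016NoBLE, §5.3.2 (first display) p. 1097] -/
theorem nobleImprovementInputsOf_of_remOf_print (hd : 9 ≤ d) {𝒮 : ι → ℕ × ℕ × Set (Site d)} {CS : ℕ}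
    {cμ : ℝ} {c : ι → ℝ} {Γ : Fin 3 → ℝ} {B : NobleBeta} {b : ι → ℝ}
    (hS : NobleImprovementInputsRemOf 𝒮 CS cμ c Γ (remPrint d CS) B b) :
    NobleImprovementInputsOf 𝒮 cμ c Γ B b :=
  hS (remValid_remPrint hd CS)

/-- **COHERENCE AT THE RECORD VALUATION (R228 (2))**: the re-cut over `𝒮` at `remKsup d CS T` IMPLIES the oracle
over `𝒮`, given the sup-table hypothesis `hT` (`d ≥ 9`, `remValid_remKsup`).
[cite: FitznerVanDerHofstad2016NoBLE, §5.3.2 (first display) p. 1097] -/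
theorem nobleImprovementInputsOf_of_remOf_ksup (hd : 9 ≤ d) {CS : ℕ} {T : Fin 4 → ℝ}
    (hT : ∀ (j : Fin 4) (x : Site d), x ≠ 0 → srwK d ((j : ℕ) + 1) (CS + 1) x ≤ T j)
    {𝒮 : ι → ℕ × ℕ × Set (Site d)} {cμ : ℝ} {c : ι → ℝ} {Γ : Fin 3 → ℝ} {B : NobleBeta} {b : ι → ℝ}
    (hS : NobleImprovementInputsRemOf 𝒮 CS cμ c Γ (remKsup d CS T) B b) :
    NobleImprovementInputsOf 𝒮 cμ c Γ B b :=
  hS (remValid_remKsup hd CS hT)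

/-! ### Stage 2 unchanged: the certificate theorems over `𝒮` with the re-cut binder -/

/-- `nobleBootstrapBound_of_certificateOf` with the improvement oracle re-cut: kernel modulo
`NobleInitialInputsOf`, the re-cut oracle at the tuple, and the validity of `R` (a kernel obligation); `d ≥ 2`.
[cite: FitznerVanDerHofstad2016NoBLE, Prop. 2.11, Def. 2.9] -/
theorem nobleBootstrapBound_of_certificateRemOf (hd : 2 ≤ d) {𝒮 : ι → ℕ × ℕ × Set (Site d)} {CS : ℕ}
    {cμ : ℝ} {c : ι → ℝ} {γ Γ : Fin 3 → ℝ} {Bi Bo : NobleBeta} {bi bo : ι → ℝ} {R : RemRead → ℝ}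
    (hN : NobleNumericCertificateOf d cμ c γ Γ Bi Bo bi bo) (hI : NobleInitialInputsOf 𝒮 Bi bi)
    (hR : RemValid d CS R) (hS : NobleImprovementInputsRemOf 𝒮 CS cμ c Γ R Bo bo) :
    NobleBootstrapBound d :=
  nobleBootstrapBound_of_certificateOf hd hN hI (hS hR)

/-- `meanField_of_certificateOf` with the improvement oracle re-cut (`d ≥ 7`): triangle condition, `θ(p_c) = 0`,
`β = 1`. [cite: FitznerVanDerHofstad2017, Thm. 1.1, §2.5] -/
theorem meanField_of_certificateRemOf (hd : 7 ≤ d) {𝒮 : ι → ℕ × ℕ × Set (Site d)} {CS : ℕ}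
    {cμ : ℝ} {c : ι → ℝ} {γ Γ : Fin 3 → ℝ} {Bi Bo : NobleBeta} {bi bo : ι → ℝ} {R : RemRead → ℝ}
    (hN : NobleNumericCertificateOf d cμ c γ Γ Bi Bo bi bo) (hI : NobleInitialInputsOf 𝒮 Bi bi)
    (hR : RemValid d CS R) (hS : NobleImprovementInputsRemOf 𝒮 CS cμ c Γ R Bo bo) :
    TriangleCondition d ∧ PercolationContinuity d ∧ BetaEqOneBoundedRatio d :=
  meanField_of_certificateOf hd hN hI (hS hR)

/-- `gamma_eq_one_of_certificateOf` with the improvement oracle re-cut (`d ≥ 7`): `γ = 1`.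
[cite: FitznerVanDerHofstad2017, Thm. 1.1 (γ = 1)] -/
theorem gamma_eq_one_of_certificateRemOf (hd : 7 ≤ d) {𝒮 : ι → ℕ × ℕ × Set (Site d)} {CS : ℕ}
    {cμ : ℝ} {c : ι → ℝ} {γ Γ : Fin 3 → ℝ} {Bi Bo : NobleBeta} {bi bo : ι → ℝ} {R : RemRead → ℝ}
    (hN : NobleNumericCertificateOf d cμ c γ Γ Bi Bo bi bo) (hI : NobleInitialInputsOf 𝒮 Bi bi)
    (hR : RemValid d CS R) (hS : NobleImprovementInputsRemOf 𝒮 CS cμ c Γ R Bo bo) :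
    ∃ A B δ : ℝ, 0 < A ∧ 0 < B ∧ 0 < δ ∧
      ∀ p : unitInterval, criticalProb (zdGraph d) (0 : Site d) - δ < p →
        (p : ℝ) < criticalProb (zdGraph d) 0 →
          ENNReal.ofReal (A / (criticalProb (zdGraph d) 0 - p)) ≤ expClusterSize (zdGraph d) 0 p ∧
            expClusterSize (zdGraph d) 0 p ≤ ENNReal.ofReal (B / (criticalProb (zdGraph d) 0 - p)) :=
  gamma_eq_one_of_certificateOf hd hN hI (hS hR)

end Literature.Probability.FitznerVanDerHofstad2017

end
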